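import Literature.AlgebraicGeometry.Resolution.ProperModelsExtension
import Literature.AlgebraicGeometry.Morphisms.NagataCompactificationProofs
import Literature.AlgebraicGeometry.Resolution.ProperModelsRegLeification
import Literature.AlgebraicGeometry.Resolution.AlterationsResolution
import HarnessLib

/-!
# Route UniversalCells — crux `LocalToGlobal` (stmt-ResolutionOfSingularities-15232), line `birth`: stub `stub_extension`

Extension of a local resolution to a partial resolution. Let `X` be an integral separated
`𝔽_p`-scheme of finite type, `U ⊆ X` open, and `g : Y → U` a resolution of singularities of `U`
(proper, birational, `Y` regular). Then there is a proper birational `π : Z → X` with `Z` INTEGRAL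
whose local rings at all points lying over `U` are regular.

Proof: if `U = ∅` take `Z = X`, `π = 𝟙`. Otherwise `U` is integral, so `Y` (reduced, birational
over `U`) is integral, and Nagata's compactification theorem (PROVED in the tree,
`Literature.AlgebraicGeometry.Morphisms.NagataCompactification_holds`) together with the closure of
the graph gives an integral `Z`, a proper `ρ : Z → X` and a dense open immersion `s : Y → Z` with
`Y = Z ×_X U` (`Literature.AlgebraicGeometry.Resolution.exists_isPullback_of_nagata`). Regularity
over `U` transfers from `Y` to `Z` along `s` (`isRegularLocalRing_stalk_of_isPullback_ι`), and `ρ`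
is an isomorphism over the image in `X` of the iso-locus `O ⊆ U` of `g`
(`isIso_morphismRestrict_image_of_isPullback`); this image is a non-empty open of the irreducible
`X`, hence dense, and its preimage in the irreducible `Z` contains `s(g⁻¹ O) ≠ ∅`, hence is dense.
-/

-- single-problem summit: the doubled namespace component `ResolutionOfSingularities` is forced
set_option linter.dupNamespace false

noncomputable section

open CategoryTheory AlgebraicGeometry TopologicalSpace
open Literature.AlgebraicGeometry.Resolution Literature.AlgebraicGeometry.Morphisms

namespace Summit.ResolutionOfSingularities.ResolutionOfSingularities.Theorems

/-- **Extension of a local resolution to a partial resolution of `X` over `U`** (Nagata 1962,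
Main Theorem; Conrad 2007, Thm. 4.1, followed by the closure of the graph). For a prime `p`, an
integral separated `𝔽_p`-scheme `X` of finite type and an open `U ⊆ X` admitting a resolution of
singularities, there is a proper birational `π : Z → X` with `Z` integral such that `𝒪_{Z,z}` is
a regular local ring for every `z` with `π z ∈ U`.
[cite: Nagata1962, Main Theorem; Conrad2007, Thm. 4.1] -/
theorem stub_extension (p : ℕ) (hp : p.Prime) (X : Scheme.{0}) (f : X ⟶ Spec (.of (ZMod p)))
    (hs : IsSeparated f) (hl : LocallyOfFiniteType f) (hq : QuasiCompact f) (hi : IsIntegral X)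
    (U : X.Opens) (hU : Scheme.HasResolution (U : Scheme.{0})) :
    ∃ (Z : Scheme.{0}) (π : Z ⟶ X), IsIntegral Z ∧ IsProper π ∧ IsBirational π ∧
      ∀ z : Z, π.base z ∈ U → IsRegularLocalRing (Z.presheaf.stalk z) := by
  -- `hs` is not needed: `IsProper g` and Nagata over the Noetherian `X` suffice
  have _hs : IsSeparated f := hs
  haveI : Fact p.Prime := ⟨hp⟩
  haveI := hl
  haveI := hq
  haveI := hi
  -- `X` is Noetherian (of finite type over the field `𝔽_p`)
  haveI : IsLocallyNoetherian X := LocallyOfFiniteType.isLocallyNoetherian f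
  haveI : CompactSpace X := QuasiCompact.compactSpace_of_compactSpace f
  haveI : IsNoetherian X := {}
  obtain ⟨Y, g, hg⟩ := hU
  by_cases hUne : (U : Set X).Nonempty
  · -- `U ≠ ∅`: `U` and `Y` are integral
    haveI : Nonempty (U : Scheme.{0}) := by
      obtain ⟨x, hx⟩ := hUne
      exact ⟨⟨x, hx⟩⟩
    haveI : IsIntegral (U : Scheme.{0}) := isIntegral_of_isOpenImmersion U.ι
    haveI : IsReduced Y := hg.isRegular.isReduced
    haveI : IsIntegral Y := hg.isBirational.isIntegral
    haveI : IsProper g := hg.isProper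
    -- Nagata compactification + closure of the graph: `Y = Z ×_X U`, `Z` integral, `ρ` proper
    obtain ⟨Z, ρ, s, hZ, hρ, hsI, -, hsq⟩ :=
      exists_isPullback_of_nagata NagataCompactification_holds U g
    haveI := hZ
    haveI := hρ
    haveI := hsI
    refine ⟨Z, ρ, hZ, hρ, ?_, ?_⟩
    · -- birationality: `ρ` is an isomorphism over the image of the iso-locus `O` of `g`
      obtain ⟨O, hOd, hOpre, hOiso⟩ := hg.isBirational
      haveI := hOiso
      haveI : IsIso (ρ ∣_ (U.ι ''ᵁ O)) := isIso_morphismRestrict_image_of_isPullback hsq O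
      refine ⟨U.ι ''ᵁ O, ?_, ?_, inferInstance⟩
      · exact (U.ι ''ᵁ O).isOpen.dense (nonempty_image_ι U hOd.nonempty)
      · refine (ρ ⁻¹ᵁ (U.ι ''ᵁ O)).isOpen.dense ?_
        obtain ⟨y, hy⟩ := hOpre.nonempty
        refine ⟨s.base y, ?_⟩
        show ρ.base (s.base y) ∈ U.ι ''ᵁ O
        rw [← Scheme.Hom.comp_apply, hsq.w, Scheme.Hom.comp_apply]
        exact ⟨g.base y, hy, rfl⟩
    · -- regularity over `U` transfers from `Y` along the open immersion `s`
      intro z hz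
      exact isRegularLocalRing_stalk_of_isPullback_ι hsq (S := (U : Set X)) subset_rfl
        (fun n _ => hg.isRegular n) z hz
  · -- `U = ∅`: the identity of `X` is a partial resolution over `U`
    refine ⟨X, 𝟙 X, hi, inferInstance, ⟨⊤, by simp, by simp, inferInstance⟩, ?_⟩
    intro z hz
    exact absurd ⟨_, hz⟩ hUne

end Summit.ResolutionOfSingularities.ResolutionOfSingularities.Theorems

end
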